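import Literature.MathematicalPhysics.QuantumFieldTheory.Balaban1983to89.B13InverseLettersOnCoerciveBallAtOne

/-!
# `Balaban1983to89.B13EntryLettersGaugeCovariant` — T. Bałaban, *Propagators for lattice gauge theories in a background field*, Commun. Math. Phys. **99** (1985)
# 389–434 [Balaban1985BackgroundPropagators], (3.28) p. 395 («(R(u)U′)(x,x′) = R(u(x))U′(x,x′)»), (3.33)–(3.34) p. 396 («Δ_a(U^u) = R(u)Δ_a(U)R(u⁻¹)»,
# «G(U^u) = R(u)G(U)R(u⁻¹)»), p. 398 («All these inequalities are invariant with respect to gauge transformations of U»), Thm 3.10 (3.107)–(3.108) p. 416;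
# *Renormalization group approach … II*, CMP **116** (1988) [Balaban1988RG2Cluster] (2.5)–(2.6) p. 12 (sandwiches of a propagator by local operators):
# ★★ (3.34) IN N10 COORDINATES — ENTRY LETTERS ARE GAUGE-COVARIANT.

statement-level composition of cited tree theorems + [folklore] matrix bookkeeping; kernel-checked; THEOREMS ONLY; nothing of NODE 00's ∕ N06's ∕ the lane's files is
modified; nothing here is a claim about the Yang–Mills mass gap; no node is discharged; count-neutral.

WHY THIS FILE (cell `pub-ymgap`, HUMAN RULING D-0062 ∕ D-0149, Track A node N10 = [B13]; width seat `pub-ymgap-dag-n10-w2` g4, CLAIM-16).  N10 reads an operator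
family `a ↦ T(a)` on a carrier `S → M_N(ℂ)` through its matrix in the product basis `B′ = (Pi.basis stdBasis).reindex σ` and records «(3.108)-letters»
`RawEntryLetters (a ↦ toMatrix B′ B′ (T a)) loc R ρ B` (holomorphic entries on the chart ball `‖a‖ < R`, decay `B·e^{−ρ·d}` between the blocks read by `loc`).
Print's (3.34) says the operators at a gauge-transformed background are the `R(u)`-conjugates.  In N10 coordinates `R(u) = conjY γ` is BLOCK-DIAGONAL over the
sites with unitary blocks (§1), so by this lineage's sandwich lemma (`B13EntryLetterAlgebra.rawEntryLetters_sandwich`, range `0`) the letters of any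
`R(u)`-intertwined family follow with the SAME radius and rate and the constant multiplied by `N⁴` (§1 `rawEntryLetters_of_intw_conjY`).  §2 instantiates this at
NODE 00's `Δ_a` and `G = Δ_a⁻¹` along ANY background family (def-Y's `deltaAY_cov ∕ GAY_cov`), §3 at the pencil through the unit background: Δ_a's and `G`'s letters
hold with ONE triple `(R′, κ, B′)` on the whole open gauge-invariant neighbourhood of the pure-gauge orbit (the `u`-saturation of the chart balls of
`B13CoerciveAlongPencilAtOne` §1 ∕ `B13InverseLettersOnCoerciveBallAtOne` §2), NO displayed hypothesis beyond `G ≤ unitaryUnits`.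
The sup-norm READING-currency twin of this transport (B9 letters, Thms 3.1–3.3's inequalities) is `B9CubeLettersGaugeTransport`; this file is the ENTRY-letter currency.
* §1 `toMatrix_conjY_apply` · `toMatrix_conjY_eq_zero_of_ne` · `norm_toMatrix_conjY_le_one` · `rowSum_toMatrix_conjY_le` · `colSum_toMatrix_conjY_le` ·
  `eq_conj_of_intw_conjY` · ★★ `rawEntryLetters_of_intw_conjY`.
* §2 ★★ `rawEntryLetters_toMatrix_deltaAY_gaugeY_of_letters` · ★★ `rawEntryLetters_toMatrix_GAY_gaugeY_of_letters` (ANY lawful letters, ANY family) and the v4-record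
  one-liners `…_parSymY_…`.
* §3 ★★ `exists_rawEntryLetters_toMatrix_deltaAY_recordV4_gaugeY_prodCfg_one_located` · ★★ `exists_rawEntryLetters_toMatrix_GAY_recordV4_gaugeY_prodCfg_one_ball`.
HONEST FRAMING: (3.34) itself is def-Y's `deltaAY_cov ∕ GAY_cov` (landed) — not re-proved here; [folklore] bookkeeping otherwise; the constant `N⁴` is crude
(row∕column sums of a unitary block are `≤ N`, not used); chart sets around `U₀ = 1`, NOT print's class (3.35); finite-lattice constants; nothing of Bałaban's
asserted beyond the cited theorems; N06 ∕ N10 NOT discharged; K1⁹ NOT claimed; counts unmoved (typed 28∕28 · discharged 5∕27); 0 `def`, 0 `sorry`, standard axioms;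
one finite 𝕋⁴ programme at fixed ε — R4 closes the conditional finite-𝕋⁴ rung `BalabanLadder.UV` only; the YM mass gap (Clay) is NOT proved by any of this; nothing
continuum ∕ ℝ⁴ ∕ OS.

References: T. Bałaban, CMP 99 (1985) 389–434 [Balaban1985BackgroundPropagators] (3.28) p.395, (3.33)–(3.35) p.396, p.398, Thm 3.4 p.400, Thm 3.10 (3.107)–(3.108)
p.416, Thm 3.11 p.416; CMP 116 (1988) 1–22 [Balaban1988RG2Cluster] (2.5)–(2.7) pp.12–13, p.15; CMP 96 (1984) 223–250 [Balaban1984PropagatorsII] p.226.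
-/

noncomputable section

namespace Literature.MathematicalPhysics.QuantumFieldTheory.Balaban1983to89.B13EntryLettersGaugeCovariant

open Metric Set Finset Module
open scoped Matrix Matrix.Norms.L2Operator
open Literature.MathematicalPhysics.QuantumFieldTheory.Balaban1983to89
open Literature.MathematicalPhysics.QuantumFieldTheory.Balaban1983to89.B9Thm37GlueTorus (tdist1 tdist1_self)
open Literature.MathematicalPhysics.QuantumFieldTheory.Balaban1983to89.B5TorusCover (UT)
open Literature.MathematicalPhysics.QuantumFieldTheory.Balaban1983to89.B13EntrywiseWalks (RawEntryLetters)
open Literature.MathematicalPhysics.QuantumFieldTheory.Balaban1983to89.B13EntryLetterAlgebra (rawEntryLetters_sandwich rawEntryLetters_congr rawEntryLetters_mono)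
open Literature.MathematicalPhysics.QuantumFieldTheory.Balaban1983to89.B13InverseOperatorCoordinates (toMatrix_piProd_apply)
open Literature.MathematicalPhysics.QuantumFieldTheory.Balaban1983to89.B13MatrixUnitBasisNumerals (norm_stdBasis_repr_le norm_stdBasis_le_one)
open Literature.MathematicalPhysics.QuantumFieldTheory.Balaban1983to89.B9Thm311AdjointAtLetters (val_inv_eq_conjTranspose)
open Literature.MathematicalPhysics.QuantumFieldTheory.Balaban1983to89.B9Eq39Adjoint (R R_def R_zero prodCfg)
open Literature.MathematicalPhysics.QuantumFieldTheory.Balaban1983to89.B6GlobalChartV1 (PV)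
open Literature.MathematicalPhysics.QuantumFieldTheory.Balaban1983to89.B6KLevelCensusIndexV1 (KIdx)
open Literature.MathematicalPhysics.QuantumFieldTheory.Balaban1983to89.B9BackgroundsKLevelV1 (bg9K)
open Literature.MathematicalPhysics.QuantumFieldTheory.Balaban1983to89.Node00
  (conjY conjY_apply conjY_mul conjY_one Intw FBondY CfgY GaugeY gaugeY gBondY SiteParY BondParY SiteOpY parSymY parBY GpY deltaAY GAY
    IsGaugeLawS IsGaugeLawB IsCovSiteOpY deltaAY_cov GAY_cov parSymY_isGaugeLawS parBY_isGaugeLawB GpY_isCovSiteOpY)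
open Literature.MathematicalPhysics.QuantumFieldTheory.Balaban1983to89.B9Thm311DeltaAGaugeOrbit (gBondY_mem_unitary)
open Literature.MathematicalPhysics.QuantumFieldTheory.Balaban1983to89.B13BlockBondReadingNumerals (bondReadingY)
open Literature.MathematicalPhysics.QuantumFieldTheory.Balaban1983to89.B13CoerciveAlongPencilAtOne (exists_rawEntryLetters_toMatrix_deltaAY_recordV4_prodCfg_one_located)
open Literature.MathematicalPhysics.QuantumFieldTheory.Balaban1983to89.B13InverseLettersOnCoerciveBallAtOne (exists_rawEntryLetters_toMatrix_GAY_recordV4_prodCfg_one_ball)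

/-! ## §1. `R(u)` in N10 coordinates: block-diagonal with unitary blocks; letters pass along `R(u)`-intertwinings -/

section Generic

variable {S : Type} [Fintype S] [DecidableEq S] {N : ℕ}
variable {ν : ℕ} {Nf : Fin ν → ℕ} [∀ j, NeZero (Nf j)]
variable {E : Type*} [NormedAddCommGroup E] [NormedSpace ℂ E]

/-- **THE MATRIX OF `R(u)` IN THE PRODUCT BASIS**: entry `((y,k),(x,l)) = [x = y]·(γ_y E_l γ_y⁻¹)_k` — block-diagonal over the sites. [folklore]
[cite: Balaban1985BackgroundPropagators, (3.28) p.395, (3.107) p.416, dictionary] -/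
theorem toMatrix_conjY_apply (γ : S → (Matrix (Fin N) (Fin N) ℂ)ˣ) (p q : S × (Fin N × Fin N)) :
    LinearMap.toMatrix
        ((Pi.basis fun _ : S => Matrix.stdBasis ℂ (Fin N) (Fin N)).reindex (Equiv.sigmaEquivProd S (Fin N × Fin N)))
        ((Pi.basis fun _ : S => Matrix.stdBasis ℂ (Fin N) (Fin N)).reindex (Equiv.sigmaEquivProd S (Fin N × Fin N))) (conjY γ) p q =
      if q.1 = p.1 then (Matrix.stdBasis ℂ (Fin N) (Fin N)).repr (R (γ p.1) (Matrix.stdBasis ℂ (Fin N) (Fin N) q.2)) p.2 else 0 := by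
  rw [toMatrix_piProd_apply, conjY_apply]
  by_cases h : q.1 = p.1
  · rw [if_pos h, h, Pi.single_eq_same]
  · rw [if_neg h, Pi.single_eq_of_ne (Ne.symm h), R_zero, map_zero, Finsupp.zero_apply]

/-- … in particular it vanishes off the diagonal blocks. [folklore] [cite: Balaban1985BackgroundPropagators, (3.28) p.395, dictionary] -/
theorem toMatrix_conjY_eq_zero_of_ne (γ : S → (Matrix (Fin N) (Fin N) ℂ)ˣ) {p q : S × (Fin N × Fin N)} (h : q.1 ≠ p.1) :
    LinearMap.toMatrix
        ((Pi.basis fun _ : S => Matrix.stdBasis ℂ (Fin N) (Fin N)).reindex (Equiv.sigmaEquivProd S (Fin N × Fin N)))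
        ((Pi.basis fun _ : S => Matrix.stdBasis ℂ (Fin N) (Fin N)).reindex (Equiv.sigmaEquivProd S (Fin N × Fin N))) (conjY γ) p q = 0 := by
  rw [toMatrix_conjY_apply, if_neg h]

/-- **UNITARY BLOCKS HAVE ENTRIES OF MODULUS `≤ 1`**: for unitary-valued `γ`, `‖toMatrix B′ B′ (R(u)) p q‖ ≤ [q.1 = p.1]` (`‖γ E_l γ⁻¹‖ ≤ ‖γ‖‖E_l‖‖γ*‖ ≤ 1`, an entry is
bounded by the operator norm). [folklore] [cite: Balaban1985BackgroundPropagators, (3.28) p.395, (3.35) p.396 («u(x) ∈ G ⊂ U(N)»)] -/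
theorem norm_toMatrix_conjY_le [NeZero N] {γ : S → (Matrix (Fin N) (Fin N) ℂ)ˣ}
    (hγ : ∀ s, ((γ s : (Matrix (Fin N) (Fin N) ℂ)ˣ) : Matrix (Fin N) (Fin N) ℂ) ∈ unitary _) (p q : S × (Fin N × Fin N)) :
    ‖LinearMap.toMatrix
        ((Pi.basis fun _ : S => Matrix.stdBasis ℂ (Fin N) (Fin N)).reindex (Equiv.sigmaEquivProd S (Fin N × Fin N)))
        ((Pi.basis fun _ : S => Matrix.stdBasis ℂ (Fin N) (Fin N)).reindex (Equiv.sigmaEquivProd S (Fin N × Fin N))) (conjY γ) p q‖ ≤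
      if q.1 = p.1 then 1 else 0 := by
  rw [toMatrix_conjY_apply]
  by_cases h : q.1 = p.1
  · rw [if_pos h, if_pos h]
    refine (norm_stdBasis_repr_le _ _).trans ?_
    rw [one_mul, R_def]
    have h1 : ‖((γ p.1 : (Matrix (Fin N) (Fin N) ℂ)ˣ) : Matrix (Fin N) (Fin N) ℂ)‖ = 1 := CStarRing.norm_of_mem_unitary (hγ p.1)
    have h2 : ‖(((γ p.1)⁻¹ : (Matrix (Fin N) (Fin N) ℂ)ˣ) : Matrix (Fin N) (Fin N) ℂ)‖ = 1 := by
      rw [val_inv_eq_conjTranspose _ (hγ p.1), ← Matrix.star_eq_conjTranspose]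
      exact CStarRing.norm_of_mem_unitary (Unitary.star_mem (hγ p.1))
    calc _ ≤ ‖((γ p.1 : (Matrix (Fin N) (Fin N) ℂ)ˣ) : Matrix (Fin N) (Fin N) ℂ) * Matrix.stdBasis ℂ (Fin N) (Fin N) q.2‖ *
          ‖(((γ p.1)⁻¹ : (Matrix (Fin N) (Fin N) ℂ)ˣ) : Matrix (Fin N) (Fin N) ℂ)‖ := norm_mul_le _ _
      _ ≤ (‖((γ p.1 : (Matrix (Fin N) (Fin N) ℂ)ˣ) : Matrix (Fin N) (Fin N) ℂ)‖ * ‖Matrix.stdBasis ℂ (Fin N) (Fin N) q.2‖) *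
          ‖(((γ p.1)⁻¹ : (Matrix (Fin N) (Fin N) ℂ)ˣ) : Matrix (Fin N) (Fin N) ℂ)‖ := mul_le_mul_of_nonneg_right (norm_mul_le _ _) (norm_nonneg _)
      _ ≤ (1 * 1) * 1 := by
          rw [h1, h2]
          exact mul_le_mul_of_nonneg_right (mul_le_mul_of_nonneg_left (norm_stdBasis_le_one _) zero_le_one) zero_le_one
      _ = 1 := by norm_num
  · rw [if_neg h, if_neg h, norm_zero]

/-- the indicator sum over one block: `Σ_q [q.1 = s] = N²`. [folklore] -/
private theorem sum_ite_fst_eq (s : S) : ∑ q : S × (Fin N × Fin N), (if q.1 = s then (1 : ℝ) else 0) = ((N * N : ℕ) : ℝ) := by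
  rw [Finset.sum_boole]
  have h : (univ.filter fun q : S × (Fin N × Fin N) => q.1 = s) = ({s} : Finset S) ×ˢ (univ : Finset (Fin N × Fin N)) := by
    ext q
    simp only [Finset.mem_filter, Finset.mem_univ, true_and, Finset.mem_product, Finset.mem_singleton, and_true]
  rw [h, Finset.card_product, Finset.card_singleton, one_mul, Finset.card_univ, Fintype.card_prod, Fintype.card_fin]

/-- **ROW SUMS `≤ N²`** of the matrix of `R(u)` (unitary-valued `u`). [folklore] [cite: Balaban1985BackgroundPropagators, (3.28) p.395; Balaban1988RG2Cluster, (2.5) p.12] -/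
theorem rowSum_toMatrix_conjY_le [NeZero N] {γ : S → (Matrix (Fin N) (Fin N) ℂ)ˣ}
    (hγ : ∀ s, ((γ s : (Matrix (Fin N) (Fin N) ℂ)ˣ) : Matrix (Fin N) (Fin N) ℂ) ∈ unitary _) (p : S × (Fin N × Fin N)) :
    ∑ q, ‖LinearMap.toMatrix
        ((Pi.basis fun _ : S => Matrix.stdBasis ℂ (Fin N) (Fin N)).reindex (Equiv.sigmaEquivProd S (Fin N × Fin N)))
        ((Pi.basis fun _ : S => Matrix.stdBasis ℂ (Fin N) (Fin N)).reindex (Equiv.sigmaEquivProd S (Fin N × Fin N))) (conjY γ) p q‖ ≤ ((N * N : ℕ) : ℝ) := by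
  rw [← sum_ite_fst_eq (N := N) p.1]
  exact sum_le_sum fun q _ => norm_toMatrix_conjY_le hγ p q

/-- **COLUMN SUMS `≤ N²`** of the matrix of `R(u)` (unitary-valued `u`). [folklore] [cite: Balaban1985BackgroundPropagators, (3.28) p.395; Balaban1988RG2Cluster, (2.5) p.12] -/
theorem colSum_toMatrix_conjY_le [NeZero N] {γ : S → (Matrix (Fin N) (Fin N) ℂ)ˣ}
    (hγ : ∀ s, ((γ s : (Matrix (Fin N) (Fin N) ℂ)ˣ) : Matrix (Fin N) (Fin N) ℂ) ∈ unitary _) (q : S × (Fin N × Fin N)) :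
    ∑ p, ‖LinearMap.toMatrix
        ((Pi.basis fun _ : S => Matrix.stdBasis ℂ (Fin N) (Fin N)).reindex (Equiv.sigmaEquivProd S (Fin N × Fin N)))
        ((Pi.basis fun _ : S => Matrix.stdBasis ℂ (Fin N) (Fin N)).reindex (Equiv.sigmaEquivProd S (Fin N × Fin N))) (conjY γ) p q‖ ≤ ((N * N : ℕ) : ℝ) := by
  rw [← sum_ite_fst_eq (N := N) q.1]
  refine sum_le_sum fun p _ => (norm_toMatrix_conjY_le hγ p q).trans (le_of_eq ?_)
  by_cases h : q.1 = p.1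
  · rw [if_pos h, if_pos h.symm]
  · rw [if_neg h, if_neg (Ne.symm h)]

omit [Fintype S] [DecidableEq S] in
/-- **AN `R(u)`-INTERTWINING IS A CONJUGATION**: `T′R(u) = R(u)T ⟹ T′ = R(u) T R(u⁻¹)` (`R(u)R(u⁻¹) = 1`). [cite: Balaban1985BackgroundPropagators, (3.31), (3.33)–(3.34) pp.395–396] -/
theorem eq_conj_of_intw_conjY (γ : S → (Matrix (Fin N) (Fin N) ℂ)ˣ) {T T' : Module.End ℂ (S → Matrix (Fin N) (Fin N) ℂ)}
    (h : Intw (conjY γ) (conjY γ) T T') : T' = conjY γ * T * conjY γ⁻¹ := by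
  have h1 : (conjY γ : Module.End ℂ (S → Matrix (Fin N) (Fin N) ℂ)) * conjY γ⁻¹ = 1 := by
    rw [Module.End.mul_eq_comp, ← conjY_mul, mul_inv_cancel, conjY_one]; rfl
  have h2 : T' * conjY γ = conjY γ * T := by
    rw [Module.End.mul_eq_comp, Module.End.mul_eq_comp]; exact h
  calc T' = T' * (conjY γ * conjY γ⁻¹) := by rw [h1, mul_one]
    _ = conjY γ * T * conjY γ⁻¹ := by rw [← mul_assoc, h2]

/-- ★★ **ENTRY LETTERS PASS ALONG `R(u)`-INTERTWININGS** — (3.34) in N10 coordinates.  Families `T T′ : E → Module.End ℂ (S → M_N(ℂ))` with `T′(a)R(u) = R(u)T(a)`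
for every `a` (`u` unitary-valued), a reading `loc = loc₀ ∘ fst` located by the site: `RawEntryLetters (a ↦ toMatrix B′B′ (T a)) loc R ρ B` (`0 ≤ ρ`) ⟹
`RawEntryLetters (a ↦ toMatrix B′B′ (T′ a)) loc R ρ (N²·N²·B)` — SAME radius, SAME rate: `toMatrix (T′ a) = M(u)·toMatrix (T a)·M(u⁻¹)` with `M(u)` block-diagonal
(range `0`) of row∕column sums `≤ N²` (this lineage's `rawEntryLetters_sandwich`).
[cite: Balaban1985BackgroundPropagators, (3.34) p.396, p.398 («invariant with respect to gauge transformations»), Thm 3.10 (3.108) p.416; Balaban1988RG2Cluster, (2.5)–(2.6) p.12] -/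
theorem rawEntryLetters_of_intw_conjY [NeZero N] {γ : S → (Matrix (Fin N) (Fin N) ℂ)ˣ}
    (hγ : ∀ s, ((γ s : (Matrix (Fin N) (Fin N) ℂ)ˣ) : Matrix (Fin N) (Fin N) ℂ) ∈ unitary _)
    {T T' : E → Module.End ℂ (S → Matrix (Fin N) (Fin N) ℂ)} (h : ∀ a, Intw (conjY γ) (conjY γ) (T a) (T' a))
    {loc₀ : S → UT Nf} {R ρ B : ℝ}
    (hA : RawEntryLetters (fun a => LinearMap.toMatrix
        ((Pi.basis fun _ : S => Matrix.stdBasis ℂ (Fin N) (Fin N)).reindex (Equiv.sigmaEquivProd S (Fin N × Fin N)))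
        ((Pi.basis fun _ : S => Matrix.stdBasis ℂ (Fin N) (Fin N)).reindex (Equiv.sigmaEquivProd S (Fin N × Fin N))) (T a))
        (fun p : S × (Fin N × Fin N) => loc₀ p.1) R ρ B) (hρ : 0 ≤ ρ) :
    RawEntryLetters (fun a => LinearMap.toMatrix
        ((Pi.basis fun _ : S => Matrix.stdBasis ℂ (Fin N) (Fin N)).reindex (Equiv.sigmaEquivProd S (Fin N × Fin N)))
        ((Pi.basis fun _ : S => Matrix.stdBasis ℂ (Fin N) (Fin N)).reindex (Equiv.sigmaEquivProd S (Fin N × Fin N))) (T' a))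
        (fun p : S × (Fin N × Fin N) => loc₀ p.1) R ρ (((N * N : ℕ) : ℝ) * ((N * N : ℕ) : ℝ) * B) := by
  have hγ' : ∀ s, ((γ⁻¹ s : (Matrix (Fin N) (Fin N) ℂ)ˣ) : Matrix (Fin N) (Fin N) ℂ) ∈ unitary _ := fun s => by
    rw [Pi.inv_apply, val_inv_eq_conjTranspose _ (hγ s), ← Matrix.star_eq_conjTranspose]
    exact Unitary.star_mem (hγ s)
  -- ranges: both conjugation matrices are block-diagonal, so every surviving pair of locations is at distance `0`
  have hrange : ∀ (δ : S → (Matrix (Fin N) (Fin N) ℂ)ˣ) (p q : S × (Fin N × Fin N)), LinearMap.toMatrix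
      ((Pi.basis fun _ : S => Matrix.stdBasis ℂ (Fin N) (Fin N)).reindex (Equiv.sigmaEquivProd S (Fin N × Fin N)))
      ((Pi.basis fun _ : S => Matrix.stdBasis ℂ (Fin N) (Fin N)).reindex (Equiv.sigmaEquivProd S (Fin N × Fin N))) (conjY δ) p q ≠ 0 →
      tdist1 Nf (loc₀ p.1) (loc₀ q.1) ≤ 0 := by
    intro δ p q hne
    by_cases hpq : q.1 = p.1
    · rw [hpq, tdist1_self]
    · exact absurd (toMatrix_conjY_eq_zero_of_ne δ hpq) hne
  have hs := rawEntryLetters_sandwich (locp := fun p : S × (Fin N × Fin N) => loc₀ p.1) hA hρ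
    (A := LinearMap.toMatrix
      ((Pi.basis fun _ : S => Matrix.stdBasis ℂ (Fin N) (Fin N)).reindex (Equiv.sigmaEquivProd S (Fin N × Fin N)))
      ((Pi.basis fun _ : S => Matrix.stdBasis ℂ (Fin N) (Fin N)).reindex (Equiv.sigmaEquivProd S (Fin N × Fin N))) (conjY γ))
    (B' := LinearMap.toMatrix
      ((Pi.basis fun _ : S => Matrix.stdBasis ℂ (Fin N) (Fin N)).reindex (Equiv.sigmaEquivProd S (Fin N × Fin N)))
      ((Pi.basis fun _ : S => Matrix.stdBasis ℂ (Fin N) (Fin N)).reindex (Equiv.sigmaEquivProd S (Fin N × Fin N))) (conjY γ⁻¹))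
    (r := 0) (Nat.cast_nonneg _) (Nat.cast_nonneg _) (hrange γ) (rowSum_toMatrix_conjY_le hγ) (hrange γ⁻¹) (colSum_toMatrix_conjY_le hγ')
  refine rawEntryLetters_mono (rawEntryLetters_congr hs fun a _ => ?_) le_rfl le_rfl (le_of_eq ?_)
  · rw [eq_conj_of_intw_conjY γ (h a), LinearMap.toMatrix_mul, LinearMap.toMatrix_mul]
  · rw [mul_zero, Real.exp_zero, mul_one]

end Generic

/-! ## §2. At NODE 00's bond sector: Δ_a's and `G`'s letters along a gauge-transformed family -/

section Bond

variable {d ℓ : ℕ} {hd : 1 ≤ d + 1} {hL : Odd (ℓ + 1) ∧ 1 < ℓ + 1} {b₀ b₁ : ℝ}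
variable (i : KIdx d ℓ hd hL b₀ b₁) {N : ℕ} [NeZero N] {G : Subgroup (Matrix (Fin N) (Fin N) ℂ)ˣ}
variable {ν : ℕ} {Nf : Fin ν → ℕ} [∀ j, NeZero (Nf j)]
variable {E : Type*} [NormedAddCommGroup E] [NormedSpace ℂ E]

/-- ★★ **Δ_a's LETTERS ALONG A GAUGE-TRANSFORMED FAMILY** (ANY lawful letters `parS parB Gp`, ANY family `F : E → CfgY`, unitary-valued `u`, site-located reading):
`RawEntryLetters (a ↦ toMatrix B′B′ (Δ_a(F a))) loc R ρ B ⟹ RawEntryLetters (a ↦ toMatrix B′B′ (Δ_a((F a)^u))) loc R ρ (N²·N²·B)` — def-Y's (3.34) `deltaAY_cov` + §1.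
[cite: Balaban1985BackgroundPropagators, (3.26) p.395, (3.34) p.396, Thm 3.10 (3.108) p.416; Balaban1988RG2Cluster, (2.5) p.12] -/
theorem rawEntryLetters_toMatrix_deltaAY_gaugeY_of_letters {parS : SiteParY (Matrix (Fin N) (Fin N) ℂ) i} {parB : BondParY (Matrix (Fin N) (Fin N) ℂ) i}
    {Gp : SiteOpY (Matrix (Fin N) (Fin N) ℂ) i} (hS : IsGaugeLawS i parS) (hB : IsGaugeLawB i parB) (hGp : IsCovSiteOpY i Gp)
    {u : GaugeY (Matrix (Fin N) (Fin N) ℂ) i} (hu : ∀ x, ((u x : (Matrix (Fin N) (Fin N) ℂ)ˣ) : Matrix (Fin N) (Fin N) ℂ) ∈ unitary _)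
    (F : E → CfgY (Matrix (Fin N) (Fin N) ℂ) i) {loc₀ : FBondY i → UT Nf} {R ρ B : ℝ}
    (hA : RawEntryLetters (fun a => LinearMap.toMatrix
        ((Pi.basis fun _ : FBondY i => Matrix.stdBasis ℂ (Fin N) (Fin N)).reindex (Equiv.sigmaEquivProd (FBondY i) (Fin N × Fin N)))
        ((Pi.basis fun _ : FBondY i => Matrix.stdBasis ℂ (Fin N) (Fin N)).reindex (Equiv.sigmaEquivProd (FBondY i) (Fin N × Fin N)))
        (deltaAY i parS parB Gp (F a))) (fun p : FBondY i × (Fin N × Fin N) => loc₀ p.1) R ρ B) (hρ : 0 ≤ ρ) :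
    RawEntryLetters (fun a => LinearMap.toMatrix
        ((Pi.basis fun _ : FBondY i => Matrix.stdBasis ℂ (Fin N) (Fin N)).reindex (Equiv.sigmaEquivProd (FBondY i) (Fin N × Fin N)))
        ((Pi.basis fun _ : FBondY i => Matrix.stdBasis ℂ (Fin N) (Fin N)).reindex (Equiv.sigmaEquivProd (FBondY i) (Fin N × Fin N)))
        (deltaAY i parS parB Gp (gaugeY i u (F a)))) (fun p : FBondY i × (Fin N × Fin N) => loc₀ p.1) R ρ
      (((N * N : ℕ) : ℝ) * ((N * N : ℕ) : ℝ) * B) :=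
  rawEntryLetters_of_intw_conjY (gBondY_mem_unitary i hu) (T := fun a => deltaAY i parS parB Gp (F a))
    (fun a => deltaAY_cov (g := u) (U := F a) hS hB hGp) hA hρ

/-- ★★ **`G`'s LETTERS ALONG A GAUGE-TRANSFORMED FAMILY** (`G = Δ_a⁻¹` by NODE 00's definition; ANY lawful letters, ANY family, unitary-valued `u`):
`RawEntryLetters (a ↦ toMatrix B′B′ (G(F a))) loc R ρ B ⟹ RawEntryLetters (a ↦ toMatrix B′B′ (G((F a)^u))) loc R ρ (N²·N²·B)` — def-Y's (3.34) `GAY_cov` + §1.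
[cite: Balaban1985BackgroundPropagators, (3.27) p.395, (3.34) p.396, Thm 3.10 (3.108) p.416; Balaban1988RG2Cluster, (2.5) p.12] -/
theorem rawEntryLetters_toMatrix_GAY_gaugeY_of_letters {parS : SiteParY (Matrix (Fin N) (Fin N) ℂ) i} {parB : BondParY (Matrix (Fin N) (Fin N) ℂ) i}
    {Gp : SiteOpY (Matrix (Fin N) (Fin N) ℂ) i} (hS : IsGaugeLawS i parS) (hB : IsGaugeLawB i parB) (hGp : IsCovSiteOpY i Gp)
    {u : GaugeY (Matrix (Fin N) (Fin N) ℂ) i} (hu : ∀ x, ((u x : (Matrix (Fin N) (Fin N) ℂ)ˣ) : Matrix (Fin N) (Fin N) ℂ) ∈ unitary _)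
    (F : E → CfgY (Matrix (Fin N) (Fin N) ℂ) i) {loc₀ : FBondY i → UT Nf} {R ρ B : ℝ}
    (hA : RawEntryLetters (fun a => LinearMap.toMatrix
        ((Pi.basis fun _ : FBondY i => Matrix.stdBasis ℂ (Fin N) (Fin N)).reindex (Equiv.sigmaEquivProd (FBondY i) (Fin N × Fin N)))
        ((Pi.basis fun _ : FBondY i => Matrix.stdBasis ℂ (Fin N) (Fin N)).reindex (Equiv.sigmaEquivProd (FBondY i) (Fin N × Fin N)))
        (GAY i parS parB Gp (F a))) (fun p : FBondY i × (Fin N × Fin N) => loc₀ p.1) R ρ B) (hρ : 0 ≤ ρ) :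
    RawEntryLetters (fun a => LinearMap.toMatrix
        ((Pi.basis fun _ : FBondY i => Matrix.stdBasis ℂ (Fin N) (Fin N)).reindex (Equiv.sigmaEquivProd (FBondY i) (Fin N × Fin N)))
        ((Pi.basis fun _ : FBondY i => Matrix.stdBasis ℂ (Fin N) (Fin N)).reindex (Equiv.sigmaEquivProd (FBondY i) (Fin N × Fin N)))
        (GAY i parS parB Gp (gaugeY i u (F a)))) (fun p : FBondY i × (Fin N × Fin N) => loc₀ p.1) R ρ
      (((N * N : ℕ) : ℝ) * ((N * N : ℕ) : ℝ) * B) :=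
  rawEntryLetters_of_intw_conjY (gBondY_mem_unitary i hu) (T := fun a => GAY i parS parB Gp (F a))
    (fun a => GAY_cov (g := u) (U := F a) hS hB hGp) hA hρ

/-- at def-Y's v4 letters of record (`parSymY ∕ parBY ∕ G′ = GpY parSymY`, lawful and covariant): Δ_a's letters along `(F a)^u` from those along `F a`.
[cite: Balaban1985BackgroundPropagators, (3.26) p.395, (3.34) p.396, Thm 3.10 (3.108) p.416] -/
theorem rawEntryLetters_toMatrix_deltaAY_parSymY_gaugeY_of_letters
    {u : GaugeY (Matrix (Fin N) (Fin N) ℂ) i} (hu : ∀ x, ((u x : (Matrix (Fin N) (Fin N) ℂ)ˣ) : Matrix (Fin N) (Fin N) ℂ) ∈ unitary _)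
    (F : E → CfgY (Matrix (Fin N) (Fin N) ℂ) i) {loc₀ : FBondY i → UT Nf} {R ρ B : ℝ}
    (hA : RawEntryLetters (fun a => LinearMap.toMatrix
        ((Pi.basis fun _ : FBondY i => Matrix.stdBasis ℂ (Fin N) (Fin N)).reindex (Equiv.sigmaEquivProd (FBondY i) (Fin N × Fin N)))
        ((Pi.basis fun _ : FBondY i => Matrix.stdBasis ℂ (Fin N) (Fin N)).reindex (Equiv.sigmaEquivProd (FBondY i) (Fin N × Fin N)))
        (deltaAY i (parSymY i) (parBY i) (GpY i (parSymY i)) (F a))) (fun p : FBondY i × (Fin N × Fin N) => loc₀ p.1) R ρ B) (hρ : 0 ≤ ρ) :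
    RawEntryLetters (fun a => LinearMap.toMatrix
        ((Pi.basis fun _ : FBondY i => Matrix.stdBasis ℂ (Fin N) (Fin N)).reindex (Equiv.sigmaEquivProd (FBondY i) (Fin N × Fin N)))
        ((Pi.basis fun _ : FBondY i => Matrix.stdBasis ℂ (Fin N) (Fin N)).reindex (Equiv.sigmaEquivProd (FBondY i) (Fin N × Fin N)))
        (deltaAY i (parSymY i) (parBY i) (GpY i (parSymY i)) (gaugeY i u (F a)))) (fun p : FBondY i × (Fin N × Fin N) => loc₀ p.1) R ρ
      (((N * N : ℕ) : ℝ) * ((N * N : ℕ) : ℝ) * B) :=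
  rawEntryLetters_toMatrix_deltaAY_gaugeY_of_letters i (parSymY_isGaugeLawS i) (parBY_isGaugeLawB i) (GpY_isCovSiteOpY (parSymY_isGaugeLawS i)) hu F hA hρ

/-- at def-Y's v4 letters of record: `G`'s letters along `(F a)^u` from those along `F a`. [cite: Balaban1985BackgroundPropagators, (3.27) p.395, (3.34) p.396, Thm 3.10 (3.108) p.416] -/
theorem rawEntryLetters_toMatrix_GAY_parSymY_gaugeY_of_letters
    {u : GaugeY (Matrix (Fin N) (Fin N) ℂ) i} (hu : ∀ x, ((u x : (Matrix (Fin N) (Fin N) ℂ)ˣ) : Matrix (Fin N) (Fin N) ℂ) ∈ unitary _)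
    (F : E → CfgY (Matrix (Fin N) (Fin N) ℂ) i) {loc₀ : FBondY i → UT Nf} {R ρ B : ℝ}
    (hA : RawEntryLetters (fun a => LinearMap.toMatrix
        ((Pi.basis fun _ : FBondY i => Matrix.stdBasis ℂ (Fin N) (Fin N)).reindex (Equiv.sigmaEquivProd (FBondY i) (Fin N × Fin N)))
        ((Pi.basis fun _ : FBondY i => Matrix.stdBasis ℂ (Fin N) (Fin N)).reindex (Equiv.sigmaEquivProd (FBondY i) (Fin N × Fin N)))
        (GAY i (parSymY i) (parBY i) (GpY i (parSymY i)) (F a))) (fun p : FBondY i × (Fin N × Fin N) => loc₀ p.1) R ρ B) (hρ : 0 ≤ ρ) :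
    RawEntryLetters (fun a => LinearMap.toMatrix
        ((Pi.basis fun _ : FBondY i => Matrix.stdBasis ℂ (Fin N) (Fin N)).reindex (Equiv.sigmaEquivProd (FBondY i) (Fin N × Fin N)))
        ((Pi.basis fun _ : FBondY i => Matrix.stdBasis ℂ (Fin N) (Fin N)).reindex (Equiv.sigmaEquivProd (FBondY i) (Fin N × Fin N)))
        (GAY i (parSymY i) (parBY i) (GpY i (parSymY i)) (gaugeY i u (F a)))) (fun p : FBondY i × (Fin N × Fin N) => loc₀ p.1) R ρ
      (((N * N : ℕ) : ℝ) * ((N * N : ℕ) : ℝ) * B) :=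
  rawEntryLetters_toMatrix_GAY_gaugeY_of_letters i (parSymY_isGaugeLawS i) (parBY_isGaugeLawB i) (GpY_isCovSiteOpY (parSymY_isGaugeLawS i)) hu F hA hρ

end Bond

/-! ## §3. At the pencil through the unit background: orbit-uniform letters on the gauge-invariant neighbourhood of the pure-gauge orbit -/

section AtOne

variable {d ℓ : ℕ} {hd : 1 ≤ d + 1} {hL : Odd (ℓ + 1) ∧ 1 < ℓ + 1} {b₀ b₁ : ℝ}
variable (i : KIdx d ℓ hd hL b₀ b₁) {N : ℕ} [NeZero N] {G : Subgroup (Matrix (Fin N) (Fin N) ℂ)ˣ}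

/-- ★★ **Δ_a's PENCIL LETTERS ON THE GAUGE-INVARIANT NEIGHBOURHOOD OF THE PURE-GAUGE ORBIT, ONE TRIPLE, NO HYPOTHESIS.**  For every `η` and every `G ≤ U(N)`:
`∃ R₁ > 0, ∃ ρ > 0, ∃ B` such that for EVERY unitary-valued gauge transformation `u`: `RawEntryLetters (A′ ↦ toMatrix B′B′ (Δ_a((e^{iηA′}·1)^u))) (bondReadingY ∘ fst) R₁ ρ B`
— `B13CoerciveAlongPencilAtOne` §1 transported by §2 (constant `× N⁴`, independent of `u`).  HONEST LABEL: chart set around the orbit of `1`, NOT print's class (3.35).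
[cite: Balaban1985BackgroundPropagators, (3.26) p.395, (3.34)–(3.35) p.396, Thm 3.4 p.400, Thm 3.10 (3.108) p.416; Balaban1988RG2Cluster, (2.5)–(2.7) pp.12–13] -/
theorem exists_rawEntryLetters_toMatrix_deltaAY_recordV4_gaugeY_prodCfg_one_located
    (hG : G ≤ B7Prop2Explicit.unitaryUnits (Matrix (Fin N) (Fin N) ℂ)) (η : ℝ) :
    ∃ R₁ : ℝ, 0 < R₁ ∧ ∃ ρ : ℝ, 0 < ρ ∧ ∃ B : ℝ, ∀ {u : GaugeY (Matrix (Fin N) (Fin N) ℂ) i},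
      (∀ x, ((u x : (Matrix (Fin N) (Fin N) ℂ)ˣ) : Matrix (Fin N) (Fin N) ℂ) ∈ unitary _) →
      RawEntryLetters (fun a : Fin (d + 1) → Site (PV d ℓ i.m i.K hd hL) 0 → Matrix (Fin N) (Fin N) ℂ =>
          LinearMap.toMatrix
            ((Pi.basis fun _ : FBondY i => Matrix.stdBasis ℂ (Fin N) (Fin N)).reindex (Equiv.sigmaEquivProd (FBondY i) (Fin N × Fin N)))
            ((Pi.basis fun _ : FBondY i => Matrix.stdBasis ℂ (Fin N) (Fin N)).reindex (Equiv.sigmaEquivProd (FBondY i) (Fin N × Fin N)))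
            (deltaAY i (parSymY i) (parBY i) (GpY i (parSymY i))
              (gaugeY i u (prodCfg ((bg9K (Matrix (Fin N) (Fin N) ℂ) G i).one) η a))))
        (fun p : FBondY i × (Fin N × Fin N) => bondReadingY i i.hN p.1) R₁ ρ B := by
  obtain ⟨R₁, hR₁, ρ, hρ, B, hA⟩ := exists_rawEntryLetters_toMatrix_deltaAY_recordV4_prodCfg_one_located i hG η
  exact ⟨R₁, hR₁, ρ, hρ, _, fun hu => rawEntryLetters_toMatrix_deltaAY_parSymY_gaugeY_of_letters i hu
    (fun a => prodCfg ((bg9K (Matrix (Fin N) (Fin N) ℂ) G i).one) η a) hA hρ.le⟩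

/-- ★★ **`G`'s PENCIL LETTERS ON THE GAUGE-INVARIANT NEIGHBOURHOOD OF THE PURE-GAUGE ORBIT, ONE TRIPLE, NO HYPOTHESIS.**  For every `η` and every `G ≤ U(N)`:
`∃ R′ > 0, ∃ κ > 0, ∃ B′` such that for EVERY unitary-valued `u`: `RawEntryLetters (A′ ↦ toMatrix B′B′ (G((e^{iηA′}·1)^u))) (bondReadingY ∘ fst) R′ κ B′` — NODE 00's
`G = Δ_a⁻¹` has the (3.108)-letters, with orbit-uniform constants, on the `u`-saturation of `B13InverseLettersOnCoerciveBallAtOne` §2's chart ball (§2 transport, `× N⁴`).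
Together with that file's §4 (clause, quantitative `hco`, print's two statements) every datum the junction displays at a background is now inhabited, hypothesis-free,
on an open gauge-invariant set around the pure-gauge orbit.  HONEST LABEL: chart set, NOT print's class (3.35) (on the torus it does not contain (3.35)); constants
existential per member.
[cite: Balaban1985BackgroundPropagators, (3.27) p.395, (3.34)–(3.35) p.396, Thm 3.4 p.400, (3.84)–(3.86) p.407, Thm 3.10 (3.108) p.416, Thm 3.11 p.416;
Balaban1988RG2Cluster, (2.5)–(2.7) pp.12–13, p.15; Balaban1984PropagatorsII, p.226] -/
theorem exists_rawEntryLetters_toMatrix_GAY_recordV4_gaugeY_prodCfg_one_ball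
    (hG : G ≤ B7Prop2Explicit.unitaryUnits (Matrix (Fin N) (Fin N) ℂ)) (η : ℝ) :
    ∃ R' : ℝ, 0 < R' ∧ ∃ κ : ℝ, 0 < κ ∧ ∃ B' : ℝ, ∀ {u : GaugeY (Matrix (Fin N) (Fin N) ℂ) i},
      (∀ x, ((u x : (Matrix (Fin N) (Fin N) ℂ)ˣ) : Matrix (Fin N) (Fin N) ℂ) ∈ unitary _) →
      RawEntryLetters (fun a : Fin (d + 1) → Site (PV d ℓ i.m i.K hd hL) 0 → Matrix (Fin N) (Fin N) ℂ =>
          LinearMap.toMatrix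
            ((Pi.basis fun _ : FBondY i => Matrix.stdBasis ℂ (Fin N) (Fin N)).reindex (Equiv.sigmaEquivProd (FBondY i) (Fin N × Fin N)))
            ((Pi.basis fun _ : FBondY i => Matrix.stdBasis ℂ (Fin N) (Fin N)).reindex (Equiv.sigmaEquivProd (FBondY i) (Fin N × Fin N)))
            (GAY i (parSymY i) (parBY i) (GpY i (parSymY i))
              (gaugeY i u (prodCfg ((bg9K (Matrix (Fin N) (Fin N) ℂ) G i).one) η a))))
        (fun p : FBondY i × (Fin N × Fin N) => bondReadingY i i.hN p.1) R' κ B' := by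
  obtain ⟨R', hR', κ, hκ, B', hL⟩ := exists_rawEntryLetters_toMatrix_GAY_recordV4_prodCfg_one_ball i hG η
  exact ⟨R', hR', κ, hκ, _, fun hu => rawEntryLetters_toMatrix_GAY_parSymY_gaugeY_of_letters i hu
    (fun a => prodCfg ((bg9K (Matrix (Fin N) (Fin N) ℂ) G i).one) η a) hL hκ.le⟩

end AtOne

end Literature.MathematicalPhysics.QuantumFieldTheory.Balaban1983to89.B13EntryLettersGaugeCovariant

end
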